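import Summits.FinalStateConjecture.FinalStateConjecture.Theorems.ClusterCompletenessAdiabaticMultiKerrILEDCutoffBulk
import Summits.FinalStateConjecture.FinalStateConjecture.Theorems.ClusterCompletenessAdiabaticMultiKerrILEDField
import Literature.Geometry.Lorentzian.MinkowskiRadialMultiplier

/-!
# Crux `AdiabaticMultiKerrILED` (line `Sketch`) — the divergence of the cut-off far-field current

Helper file for the crux `stmt-FinalStateConjecture-14310`
(`Summit.FinalStateConjecture.FinalStateConjecture.Theses.ClusterCompleteness.AdiabaticMultiKerrILED`),
far-field stub `stub_farTransport`: for a solution `ψ` of the crux's equation `□_G ψ = 0` on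
`{t ≥ 0} ∩ {exterior}`, a smooth cut-off `ζ` nonzero only where every rest-frame radius exceeds `16Mᵢ`
(so that `G = η` there), a radial multiplier `X_g` and weight `ϖ`, the flat modified current
`J = J^{ζX_g}_η[ψ − c] + ¼ L^{ζϖ}_η[ψ − c]` has, at every point with `t ≥ 0`, divergence
`ζ (K^{X_g} + ¼ ϖ Q − ⅛ (□_η ϖ)(ψ − c)²) + (∑ (J^{X_g})^μ ∂_μζ − ⅛ (2η(dζ,dϖ) + ϖ □_η ζ)(ψ − c)²)`
(`far_divergence_eq`; the source term vanishes because `□_η ψ = □_G ψ = 0` where `ζ ≠ 0`,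
`waveOperator_eta_eq_zero_of_far`). [folklore]
-/

noncomputable section

-- the doubled `FinalStateConjecture.FinalStateConjecture` path component trips dupNamespace
set_option linter.dupNamespace false

open scoped ContDiff Topology
open Filter Set Literature.Geometry.Lorentzian Literature.Geometry.Lorentzian.KerrSchild

namespace Summit.FinalStateConjecture.FinalStateConjecture.Cruxes.AdiabaticMultiKerrILED.Sketch

/-! ### The divergence of the cut-off far current -/

section FarDivergence

open Summit.FinalStateConjecture.FinalStateConjecture.Theorems

/-- `□_G (ψ − c) = □_G ψ`. [folklore] -/
theorem waveOperator_sub_const (G : E4 → Fin 4 → Fin 4 → ℝ) (ψ : E4 → ℝ) (c : ℝ) (x : E4) :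
    waveOperator G (fun y ↦ ψ y - c) x = waveOperator G ψ x := by
  unfold waveOperator
  have : ∀ y : E4, fderiv ℝ (fun z ↦ ψ z - c) y = fderiv ℝ ψ y := fun y ↦ fderiv_sub_const c
  simp only [this]

/-- **Where the cut-off is active the crux's solution solves the flat wave equation.** Under the
crux hypotheses on `q`, `M` and `G`, if `ψ` solves `□_G ψ = 0` on `{t ≥ 0} ∩ {r₊ᵢ < rᵢ}` then at every
point `x` with `x⁰ ≥ 0` and `16Mᵢ < rᵢ(qᵢ x)` for all `i` (an open condition, on which `G = η`),
`□_η ψ (x) = 0`. [folklore] -/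
theorem waveOperator_eta_eq_zero_of_far {N : ℕ} {M a : Fin N → ℝ} {Λ : Fin N → lorentzGroup} {p : Fin N → E3}
    {q : Fin N → E4 → E4} {G : E4 → Fin 4 → Fin 4 → ℝ}
    (hq : ∀ i x, q i x = poincareInv (Λ i) (E4.ofTimeSpace 0 (p i)) x) (hM : ∀ i, 0 < M i)
    (hG : ∀ x μ ν, G x μ ν = Minkowski.bilin (E4.basisVector μ) (E4.basisVector ν) -
      ∑ i, Real.smoothTransition (2 - Kerr.radius (a i) (q i x) / (8 * M i)) *
        (2 * Kerr.scalarH (M i) (a i) (q i x)) *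
        ((Λ i : E4 ≃L[ℝ] E4) (Kerr.nullVector (a i) (q i x))) μ *
        ((Λ i : E4 ≃L[ℝ] E4) (Kerr.nullVector (a i) (q i x))) ν)
    {ψ : E4 → ℝ}
    (hsol : ∀ x : E4, 0 ≤ x 0 → (∀ i, Kerr.rPlus (M i) (a i) < Kerr.radius (a i) (q i x)) →
      waveOperator G ψ x = 0)
    {x : E4} (hx0 : 0 ≤ x 0) (hfar : ∀ i, 16 * M i < Kerr.radius (a i) (q i x)) :
    waveOperator (fun _ ↦ Kerr.etaComp) ψ x = 0 := by
  -- `G = η` on the open neighbourhood `{∀ i, 16 Mᵢ < rᵢ}` of `x`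
  have hopen : ∀ᶠ y in 𝓝 x, ∀ i, 16 * M i < Kerr.radius (a i) (q i y) := by
    refine Filter.eventually_all.mpr fun i ↦ ?_
    have hc : Continuous fun y ↦ Kerr.radius (a i) (q i y) := by
      have : (fun y ↦ Kerr.radius (a i) (q i y)) =
          fun y ↦ Kerr.radius (a i) (poincareInv (Λ i) (E4.ofTimeSpace 0 (p i)) y) := by
        funext y; rw [hq]
      rw [this]
      exact (Kerr.continuous_radius _).comp (continuous_poincareInv _ _)
    exact (isOpen_lt continuous_const hc).mem_nhds (hfar i)
  have hGη : ∀ μ ν, (fun y ↦ G y μ ν) =ᶠ[𝓝 x] fun _ ↦ Kerr.etaComp μ ν := by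
    intro μ ν
    filter_upwards [hopen] with y hy
    exact cruxField_eq_etaComp_of_far hG hM (fun i ↦ (hy i).le) μ ν
  rw [← waveOperator_congr_of_eventuallyEq hGη ψ]
  refine hsol x hx0 fun i ↦ lt_trans ?_ (hfar i)
  -- `r₊ ≤ 2M < 16M`
  have h2 : Kerr.rPlus (M i) (a i) ≤ 2 * M i := by
    unfold Kerr.rPlus
    have : Real.sqrt (M i ^ 2 - a i ^ 2) ≤ M i := by
      calc Real.sqrt (M i ^ 2 - a i ^ 2) ≤ Real.sqrt (M i ^ 2) :=
            Real.sqrt_le_sqrt (sub_le_self _ (sq_nonneg _))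
        _ = M i := Real.sqrt_sq (hM i).le
    linarith
  linarith [hM i]

/-- **The divergence of the cut-off far current.** Let `X_g^0 = 0`, `X_gⁱ = g(|y⃗|²) yᵢ`, `ϖ` a
radial weight, `ζ` a smooth cut-off which is nonzero only where every rest-frame radius exceeds
`16Mᵢ`, and `φ = ψ − c` for a solution `ψ` of the crux's equation. Then for `x⁰ ≥ 0` the flat modified
current `J = J^{ζX_g}_η[φ] + ¼ L^{ζϖ}_η[φ]` has divergence
`ζ · (K^{X_g} + ¼ ϖ Q − ⅛ (□_η ϖ) φ²) + (∑_μ (J^{X_g})^μ ∂_μζ − ⅛ (2 η(dζ, dϖ) + ϖ □_η ζ) φ²)`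
(the source term `(Xφ + ¼ ϖ̃ φ) □_η φ` vanishes: where `ζ ≠ 0`, `□_η φ = □_G ψ = 0`; where `ζ = 0`,
`X = 0` and `ϖ̃ = 0`). [folklore] -/
theorem far_divergence_eq {N : ℕ} {M a : Fin N → ℝ} {Λ : Fin N → lorentzGroup} {p : Fin N → E3}
    {q : Fin N → E4 → E4} {G : E4 → Fin 4 → Fin 4 → ℝ}
    (hq : ∀ i x, q i x = poincareInv (Λ i) (E4.ofTimeSpace 0 (p i)) x) (hM : ∀ i, 0 < M i)
    (hG : ∀ x μ ν, G x μ ν = Minkowski.bilin (E4.basisVector μ) (E4.basisVector ν) -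
      ∑ i, Real.smoothTransition (2 - Kerr.radius (a i) (q i x) / (8 * M i)) *
        (2 * Kerr.scalarH (M i) (a i) (q i x)) *
        ((Λ i : E4 ≃L[ℝ] E4) (Kerr.nullVector (a i) (q i x))) μ *
        ((Λ i : E4 ≃L[ℝ] E4) (Kerr.nullVector (a i) (q i x))) ν)
    {ψ : E4 → ℝ} (hψ : ContDiff ℝ ∞ ψ)
    (hsol : ∀ x : E4, 0 ≤ x 0 → (∀ i, Kerr.rPlus (M i) (a i) < Kerr.radius (a i) (q i x)) →
      waveOperator G ψ x = 0)
    (c : ℝ) {g ϖ : ℝ → ℝ} (hg : ContDiff ℝ ∞ fun y : E4 ↦ g (E4.spatialNorm y ^ 2))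
    (hϖ : ContDiff ℝ ∞ fun y : E4 ↦ ϖ (E4.spatialNorm y ^ 2))
    {ζ : E4 → ℝ} (hζ : ContDiff ℝ ∞ ζ)
    (hζfar : ∀ x, ζ x ≠ 0 → ∀ i, 16 * M i < Kerr.radius (a i) (q i x))
    {x : E4} (hx0 : 0 ≤ x 0) :
    ∑ μ, fderiv ℝ (fun y ↦
        multiplierCurrent (fun _ ↦ Kerr.etaComp)
          (fun z α ↦ ζ z * (if α = 0 then (0 : ℝ) else g (E4.spatialNorm z ^ 2) * z α))
          (fun z ↦ ψ z - c) y μ +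
        4⁻¹ * lagrangianCurrent (fun _ ↦ Kerr.etaComp) (fun z ↦ ζ z * ϖ (E4.spatialNorm z ^ 2))
          (fun z ↦ ψ z - c) y μ) x (E4.basisVector μ) =
      ζ x * (multiplierBulk (fun _ ↦ Kerr.etaComp)
          (fun z α ↦ if α = 0 then (0 : ℝ) else g (E4.spatialNorm z ^ 2) * z α) (fun z ↦ ψ z - c) x +
        4⁻¹ * (ϖ (E4.spatialNorm x ^ 2) * ∑ α, ∑ β, Kerr.etaComp α β *
          fderiv ℝ (fun z ↦ ψ z - c) x (E4.basisVector α) *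
          fderiv ℝ (fun z ↦ ψ z - c) x (E4.basisVector β)) -
        8⁻¹ * waveOperator (fun _ ↦ Kerr.etaComp) (fun z ↦ ϖ (E4.spatialNorm z ^ 2)) x *
          (ψ x - c) ^ 2) +
      (∑ μ, multiplierCurrent (fun _ ↦ Kerr.etaComp)
          (fun z α ↦ if α = 0 then (0 : ℝ) else g (E4.spatialNorm z ^ 2) * z α) (fun z ↦ ψ z - c) x μ *
          fderiv ℝ ζ x (E4.basisVector μ) -
        8⁻¹ * (2 * (∑ μ, ∑ ν, Kerr.etaComp μ ν * fderiv ℝ ζ x (E4.basisVector μ) *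
          fderiv ℝ (fun z : E4 ↦ ϖ (E4.spatialNorm z ^ 2)) x (E4.basisVector ν)) +
          ϖ (E4.spatialNorm x ^ 2) * waveOperator (fun _ ↦ Kerr.etaComp) ζ x) * (ψ x - c) ^ 2) := by
  -- abbreviations
  set η : E4 → Fin 4 → Fin 4 → ℝ := fun _ ↦ Kerr.etaComp with hη
  set Xg : E4 → Fin 4 → ℝ := fun z α ↦ if α = 0 then (0 : ℝ) else g (E4.spatialNorm z ^ 2) * z α with hXg
  set φ : E4 → ℝ := fun z ↦ ψ z - c with hφ
  set ϖs : E4 → ℝ := fun z ↦ ϖ (E4.spatialNorm z ^ 2) with hϖs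
  have hηd : ∀ μ ν, DifferentiableAt ℝ (fun y ↦ η y μ ν) x := fun μ ν ↦ differentiableAt_const _
  have hηs : ∀ μ ν, η x μ ν = η x ν μ := fun μ ν ↦ by
    simp only [hη, KerrSchild.etaComp_eq]
    by_cases h : μ = ν
    · subst h; rfl
    · simp [h, Ne.symm h]
  have hφ2 : ContDiff ℝ ∞ φ := hψ.sub contDiff_const
  have hφx : ContDiffAt ℝ 2 φ x := (hφ2.of_le (by norm_cast)).contDiffAt
  have hζx : ContDiffAt ℝ 2 ζ x := (hζ.of_le (by norm_cast)).contDiffAt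
  have hϖx : ContDiffAt ℝ 2 ϖs x := (hϖ.of_le (by norm_cast)).contDiffAt
  have hXgd : ∀ α, DifferentiableAt ℝ (fun y ↦ Xg y α) x := by
    intro α
    by_cases hα0 : α = 0
    · simp [hXg, hα0]
    · simp only [hXg, hα0, if_false]
      exact ((hg.differentiable (by simp)) x).mul (KerrSchild.hasFDerivAt_coord α x).differentiableAt
  have hXd : ∀ α, DifferentiableAt ℝ (fun y ↦ ζ y * Xg y α) x := fun α ↦
    ((hζ.differentiable (by simp)) x).mul (hXgd α)
  have hϖζ : ContDiffAt ℝ 2 (fun y ↦ ζ y * ϖs y) x := hζx.mul hϖx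
  -- the general divergence identity with the constant coefficients `η`
  have hdiv := sum_fderiv_modifiedCurrent (G := η) (X := fun y α ↦ ζ y * Xg y α) (ϖ := fun y ↦ ζ y * ϖs y)
    (w := φ) (x := x) hηd hηs hXd hϖζ hφx
  -- the source term vanishes
  have hsource : ((∑ α, (ζ x * Xg x α) * fderiv ℝ φ x (E4.basisVector α)) + 4⁻¹ * ((ζ x * ϖs x) * φ x)) *
      waveOperator η φ x = 0 := by
    by_cases hz : ζ x = 0
    · simp [hz]
    · have hbox : waveOperator η φ x = 0 := by
        rw [hφ, waveOperator_sub_const]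
        exact waveOperator_eta_eq_zero_of_far hq hM hG hsol hx0 (hζfar x hz)
      rw [hbox, mul_zero]
  rw [hsource, zero_add] at hdiv
  rw [hdiv, modifiedBulk_cutoff_eq φ hηd hηs hXgd hζx hϖx]
  simp only [hϖs, hφ, hη]
  ring

end FarDivergence

end Summit.FinalStateConjecture.FinalStateConjecture.Cruxes.AdiabaticMultiKerrILED.Sketch

end
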